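import Mathlib
import Literature.AlgebraicGeometry.Resolution.AffineBlowup
import Literature.AlgebraicGeometry.Resolution.AffineDomainDimension
import Literature.FieldTheory.Regular.RegularBaseChange
import HarnessLib

/-!
# `SectionAscent.GenericLevel`, line `registered`: generic sections inherit one-shot resolvability

Route `ResolutionOfSingularities/SectionAscent`, crux `GenericLevel`
(stmt-ResolutionOfSingularities-15959), stub `stub_genericSectionsResolvable` of the lead's skeleton
`work/GenericLevel.lean`, PROVED here (statement verbatim from the ledger registration).

**Statement (dimension / base-change transport).** Fix a prime `p` and `d : ℕ` and assume
`OneShot p d`: every integral affine algebra `A'` of finite type over a field `K'` of characteristic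
`p` with `dim A' < d` has an ideal `I ≠ 0` whose blowing up is regular and with `V(I) = Sing(Spec A')`
exactly. Let `K` be a field of characteristic `p`, `A` an integral `K`-algebra of finite type with
`dim A < d + 1`, `I₀ ≠ 0` an ideal, `m ≥ 1`, `h : Fin s → A` a family generating `I₀ ^ m`. Put
`K(t) = Frac K[t₁, …, tₛ]`, `T = K(t) ⊗_K A` and `ℓ = Σ_j t_j ⊗ h_j ∈ T` (the generic member of the
linear system `I₀ ^ m`). Then every DOMAIN `C` onto which `T ⧸ (ℓ)` surjects satisfies the conclusion of
`OneShot p d` (over the field `K(t)`).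

**Proof (Huneke–Swanson §8.4; Matsumura Thm 5.6, §14).**
1. `T = K(t) ⊗_K A` is an integral domain: it is the localisation of the domain
   `K[t] ⊗_K A ≅ A[t₁, …, tₛ]` at the image of `K[t] ∖ {0}`, which consists of non-zero elements
   (`isDomain_fractionRing_mvPolynomial_tensorProduct`, from Mathlib's `IsLocalization.tensor`,
   `MvPolynomial.algebraTensorAlgEquiv`, `Algebra.TensorProduct.cancelBaseChange`).
2. `dim T = dim A =: n ≤ d` (tree: `Literature.FieldTheory.Regular.ringKrullDim_tensorProduct_eq_of_isDomain`,
   the base change of an affine domain is equidimensional of the same dimension; and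
   `Literature.AlgebraicGeometry.Resolution.exists_ringKrullDim_eq_and_trdeg_eq`, `dim A ∈ ℕ`).
3. `ℓ ≠ 0`: some `h_{j₀} ≠ 0` (`I₀ ^ m ≠ 0` in a domain), the `t_j` are `K`-linearly independent in
   `K(t)`, so a `K`-linear functional `f` on `K(t)` with `f(t_j) = δ_{j j₀}` exists
   (`LinearMap.exists_extend`) and `(f ⊗ id)(ℓ) = h_{j₀} ≠ 0`.
4. Hence `ℓ` is a non-zero-divisor of `T`, and for the surjection `T → T ⧸ (ℓ) → C` Mathlib's
   `ringKrullDim_succ_le_of_surjective` gives `dim C + 1 ≤ dim T = n ≤ d`, so `dim C < d`.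
5. `C` is a `K(t)`-algebra of finite type (base change, quotient, surjection), `K(t)` is a field of
   characteristic `p`; apply `OneShot p d` to `(K(t), C)`.
-/

noncomputable section

-- single-problem summit: the doubled namespace component `ResolutionOfSingularities` is mandated
set_option linter.dupNamespace false

open scoped TensorProduct nonZeroDivisors

namespace Summit.ResolutionOfSingularities.ResolutionOfSingularities.Theorems

/-- **`K(t₁, …, t_ι) ⊗_K A` is an integral domain** for an integral `K`-algebra `A` over a field `K`:
it is the localisation of the domain `K[t] ⊗_K A ≅ A[t]` at the image of `K[t] ∖ {0}`, and
`K[t] → K[t] ⊗_K A` is injective (`A ≠ 0` is flat over the field `K`), so that image consists of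
non-zero elements. (The case of a field `A` is
`Literature.AlgebraicGeometry.Motives.isDomain_tensorProduct_fractionRing_mvPolynomial`; same proof.)
[folklore] -/
theorem isDomain_fractionRing_mvPolynomial_tensorProduct (K A : Type*) [Field K] [CommRing A]
    [IsDomain A] [Algebra K A] (ι : Type*) :
    IsDomain (FractionRing (MvPolynomial ι K) ⊗[K] A) := by
  set P := MvPolynomial ι K with hP
  set Q := FractionRing (MvPolynomial ι K) with hQ
  -- `P ⊗_K A ≅ A[t]` is a domain
  haveI : IsDomain (P ⊗[K] A) :=
    MulEquiv.isDomain (MvPolynomial ι A)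
      ((Algebra.TensorProduct.comm K P A).trans
        ((MvPolynomial.algebraTensorAlgEquiv K A).restrictScalars K)).toMulEquiv
  -- `(P ⊗_K A) ⊗_P Q` is the localisation of `P ⊗_K A` at the image of `P ∖ {0}`
  haveI : IsLocalization (Algebra.algebraMapSubmonoid (P ⊗[K] A) P⁰) ((P ⊗[K] A) ⊗[P] Q) :=
    IsLocalization.tensor Q P⁰
  haveI : IsDomain ((P ⊗[K] A) ⊗[P] Q) := by
    refine IsLocalization.isDomain_of_le_nonZeroDivisors
      (M := Algebra.algebraMapSubmonoid (P ⊗[K] A) P⁰) ((P ⊗[K] A) ⊗[P] Q) ?_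
    rintro _ ⟨q, hq, rfl⟩
    refine mem_nonZeroDivisors_of_ne_zero fun h => nonZeroDivisors.ne_zero hq ?_
    have hinj : Function.Injective
        (Algebra.TensorProduct.includeLeft (R := K) (S := K) (A := P) (B := A)) :=
      Algebra.TensorProduct.includeLeft_injective (algebraMap K A).injective
    exact hinj (by rw [map_zero]; exact h)
  -- transport along `Q ⊗_K A ≃ Q ⊗_P (P ⊗_K A) ≃ (P ⊗_K A) ⊗_P Q`
  exact MulEquiv.isDomain ((P ⊗[K] A) ⊗[P] Q)
    ((Algebra.TensorProduct.cancelBaseChange K P Q Q A).symm.toRingEquiv.trans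
      (Algebra.TensorProduct.comm P Q (P ⊗[K] A)).toRingEquiv).toMulEquiv

/-- **Generic sections inherit one-shot resolvability (stub `stub_genericSectionsResolvable` of the
crux `GenericLevel`).** Hypotheses: `p` prime, `d`, the route's `OneShot p d` (one-shot strong
resolution of integral affine varieties of dimension `< d` over all fields of characteristic `p`),
a field `K` of characteristic `p`, an integral `K`-algebra `A` of finite type with `dim A < d + 1`,
an ideal `I₀ ≠ 0`, `m ≥ 1`, a finite family `h` generating `I₀ ^ m`. Conclusion: every domain `C`
onto which the generic-member ring `(K(t₁, …, tₛ) ⊗_K A) ⧸ (Σ_j t_j ⊗ h_j)` surjects is one-shot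
resolvable. Proof: `K(t) ⊗_K A` is a domain of finite type over the field `K(t)` of characteristic
`p`, of dimension `dim A ≤ d`; `Σ t_j ⊗ h_j ≠ 0`, so every domain quotient of the generic-member
ring has dimension `< d` (`ringKrullDim_succ_le_of_surjective`); apply `OneShot p d` over `K(t)`.
[cite: Matsumura1987, Thm 5.6 / §14] -/
theorem stub_genericSectionsResolvable :
    ∀ p : ℕ, p.Prime → ∀ d : ℕ,
      (∀ (K : Type) [Field K] [CharP K p] (A : Type) [CommRing A] [IsDomain A] [Algebra K A]
          [Algebra.FiniteType K A], ringKrullDim A < (d : WithBot ℕ∞) →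
          ∃ I : Ideal A, I ≠ ⊥ ∧
            Literature.AlgebraicGeometry.Resolution.Scheme.IsRegular
              (Literature.AlgebraicGeometry.Resolution.affineBlowup I) ∧
            ∀ 𝔭 : PrimeSpectrum A, I ≤ 𝔭.asIdeal ↔
              ¬ IsRegularLocalRing (Localization.AtPrime 𝔭.asIdeal)) →
      ∀ (K : Type) [Field K] [CharP K p] (A : Type) [CommRing A] [IsDomain A] [Algebra K A]
        [Algebra.FiniteType K A], ringKrullDim A < ((d + 1 : ℕ) : WithBot ℕ∞) →
        ∀ I₀ : Ideal A, I₀ ≠ ⊥ → ∀ (m s : ℕ) (h : Fin s → A), 0 < m →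
          Ideal.span (Set.range h) = I₀ ^ m →
          ∀ (C : Type) [CommRing C] [IsDomain C]
            (π : (TensorProduct K (FractionRing (MvPolynomial (Fin s) K)) A ⧸
              Ideal.span {∑ j : Fin s, (algebraMap (MvPolynomial (Fin s) K)
                (FractionRing (MvPolynomial (Fin s) K)) (MvPolynomial.X j)) ⊗ₜ[K] h j}) →+* C),
            Function.Surjective π →
            ∃ J : Ideal C, J ≠ ⊥ ∧
              Literature.AlgebraicGeometry.Resolution.Scheme.IsRegular
                (Literature.AlgebraicGeometry.Resolution.affineBlowup J) ∧
              ∀ 𝔭 : PrimeSpectrum C, J ≤ 𝔭.asIdeal ↔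
                ¬ IsRegularLocalRing (Localization.AtPrime 𝔭.asIdeal) := by
  intro p _hp d hOne K _ _ A _ _ _ _ hdim I₀ hI₀ m s h _hm hspan C _ _ π hπ
  classical
  -- ### Step 0: some `h j₀ ≠ 0`
  have hpow : I₀ ^ m ≠ ⊥ := by
    rw [← Ideal.zero_eq_bot] at hI₀ ⊢
    exact pow_ne_zero m hI₀
  obtain ⟨j₀, hj₀⟩ : ∃ j₀, h j₀ ≠ 0 := by
    by_contra hall
    apply hpow
    rw [← hspan, Ideal.span_eq_bot]
    rintro _ ⟨j, rfl⟩
    exact not_not.mp (not_exists.mp hall j)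
  -- ### Notation (`let`, not `set`: `π`'s type must not be rewritten)
  let Ps : Type := MvPolynomial (Fin s) K
  let Ks : Type := FractionRing (MvPolynomial (Fin s) K)
  let ℓ : Ks ⊗[K] A := ∑ j : Fin s, (algebraMap Ps Ks (MvPolynomial.X j)) ⊗ₜ[K] h j
  have hℓ : ℓ = ∑ j : Fin s, (algebraMap Ps Ks (MvPolynomial.X j)) ⊗ₜ[K] h j := rfl
  -- ### Step 1: `T = K(t) ⊗_K A` is a domain
  haveI hT : IsDomain (Ks ⊗[K] A) := isDomain_fractionRing_mvPolynomial_tensorProduct K A (Fin s)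
  -- ### Step 2: `dim T = dim A = n ≤ d`
  obtain ⟨n, hn, -⟩ :=
    Literature.AlgebraicGeometry.Resolution.exists_ringKrullDim_eq_and_trdeg_eq K A
  have hnd : n ≤ d := by
    rw [hn] at hdim
    have : n < d + 1 := by exact_mod_cast hdim
    omega
  haveI : IsDomain (A ⊗[K] Ks) :=
    MulEquiv.isDomain (Ks ⊗[K] A) (Algebra.TensorProduct.comm K A Ks).toMulEquiv
  have hdimT : ringKrullDim (Ks ⊗[K] A) = n := by
    rw [ringKrullDim_eq_of_ringEquiv (Algebra.TensorProduct.comm K Ks A).toRingEquiv,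
      Literature.FieldTheory.Regular.ringKrullDim_tensorProduct_eq_of_isDomain (L := K) (F' := Ks) A,
      hn]
  -- ### Step 3: `ℓ ≠ 0`
  have hli : LinearIndependent K (fun j : Fin s => algebraMap Ps Ks (MvPolynomial.X j)) :=
    (MvPolynomial.linearIndependent_X (Fin s) K).map'
      (IsScalarTower.toAlgHom K Ps Ks).toLinearMap
      (LinearMap.ker_eq_bot.mpr (IsFractionRing.injective Ps Ks))
  obtain ⟨f, hf⟩ := LinearMap.exists_extend ((Finsupp.lapply j₀).comp hli.repr)
  have hft : ∀ j : Fin s, f (algebraMap Ps Ks (MvPolynomial.X j)) = if j = j₀ then (1 : K) else 0 := by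
    intro j
    have hj : algebraMap Ps Ks (MvPolynomial.X j) ∈
        Submodule.span K (Set.range fun j : Fin s => algebraMap Ps Ks (MvPolynomial.X j)) :=
      Submodule.subset_span ⟨j, rfl⟩
    have h1 := LinearMap.congr_fun hf ⟨_, hj⟩
    rw [LinearMap.comp_apply, Submodule.subtype_apply, LinearMap.comp_apply,
      hli.repr_eq_single j ⟨_, hj⟩ rfl, Finsupp.lapply_apply, Finsupp.single_apply] at h1
    exact h1
  have hℓ0 : ℓ ≠ 0 := by
    intro h0
    apply hj₀
    have h2 : TensorProduct.lid K A (LinearMap.rTensor A f ℓ) = h j₀ := by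
      simp only [hℓ, map_sum, LinearMap.rTensor_tmul, TensorProduct.lid_tmul, hft, ite_smul,
        one_smul, zero_smul, Finset.sum_ite_eq', Finset.mem_univ, if_true]
    rw [← h2, h0, map_zero, map_zero]
  -- ### Step 4: `dim C + 1 ≤ dim T = n`
  have hsurj : Function.Surjective (π.comp (Ideal.Quotient.mk (Ideal.span {ℓ}))) :=
    hπ.comp Ideal.Quotient.mk_surjective
  have hC : ringKrullDim C + 1 ≤ n := by
    rw [← hdimT]
    refine ringKrullDim_succ_le_of_surjective _ hsurj (mem_nonZeroDivisors_of_ne_zero hℓ0) ?_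
    rw [RingHom.comp_apply, Ideal.Quotient.eq_zero_iff_mem.mpr (Ideal.mem_span_singleton_self ℓ),
      map_zero]
  -- ### Step 5: `C` is a `K(t)`-algebra of finite type of dimension `< d`; apply `OneShot p d`
  letI : Algebra Ks C := (π.comp (algebraMap Ks ((Ks ⊗[K] A) ⧸ Ideal.span {ℓ}))).toAlgebra
  let πa : ((Ks ⊗[K] A) ⧸ Ideal.span {ℓ}) →ₐ[Ks] C := ⟨π, fun _ => rfl⟩
  haveI : Algebra.FiniteType Ks C := Algebra.FiniteType.of_surjective πa fun c => hπ c
  obtain ⟨nC, hnC, -⟩ :=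
    Literature.AlgebraicGeometry.Resolution.exists_ringKrullDim_eq_and_trdeg_eq Ks C
  have hlt : ringKrullDim C < (d : WithBot ℕ∞) := by
    rw [hnC] at hC ⊢
    have : nC + 1 ≤ n := by exact_mod_cast hC
    exact_mod_cast (show nC < d by omega)
  exact hOne Ks C hlt

end Summit.ResolutionOfSingularities.ResolutionOfSingularities.Theorems

end
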